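import Summits.AtomisticToContinuum.FouriersLaw.Theorems.LatticeLandauDampingAbelThermodynamicLimitBulkWindowEquivalenceFiniteDLR
import Summits.AtomisticToContinuum.FouriersLaw.Theorems.PhononMeanFreePathIncoherentChannelLightConeHelper5
import Literature.MathematicalPhysics.KineticTheory.InfiniteChainTightRegular
import Literature.MathematicalPhysics.KineticTheory.InfiniteChainStates
import Mathlib.MeasureTheory.Function.Floor

/-!
# Stub (E1) `stub_bulkWindowEquivalence`: anchor-uniform bulk equivalence of ensembles — PROVED

`--supports stmt-AtomisticToContinuum-14013` for the line `series-law-at-every-laplace-frequency` (SketchIdeator2) of the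
crux `LatticeLandauDamping.AbelThermodynamicLimit`; proves the registered stub `stub_bulkWindowEquivalence` (rev 7, the
STATIC engine of the fixed-time matching (B′)) VERBATIM.

Statement: for `P = pinnedChain ω₂ lam β γ` (all `> 0`), `T > 0` and a regular DLR state `μT` (DLR + shift-invariant
+ BM-superstable), every bounded measurable window observable `f` on `PhaseSpace (m+1)` (`|f| ≤ 1`) and `ε > 0` admit
a depth `L` and `N₀` such that for all `N ≥ N₀` and all `L`-deep windows `[i, i+m] ⊆ [0, N-1]`,
`|E_{gibbsMeasure N T}[f((q,p)|_{[i,i+m]})] - E_{μT}[f ∘ boxPhaseAt 0 m]| ≤ ε`.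

Proof (folklore assembly of tree results):
* the free finite-volume Gibbs state is DLR in the bulk for the infinite-chain specification, so a window-event
  probability is within `ε + (boundary tails)` of the boundary-limit value `L_A` of
  `OscillatorChain.chainSpecification_Icc_tendsto_uniformly` (registered helper `pinnedChain_windowEventDLREstimate`,
  file `…BulkWindowEquivalenceFiniteDLR`);
* the boundary tails are `N`-uniform: `μ_{N,T}{R < |q_j|} ≤ C/R²` from the `N`-uniform second moments
  `PhononMeanFreePath.lightCone_gibbs_position_moments` (`BulkWindow.pinnedChain_gibbsMeasure_real_position_tail_le`);
* `μT{A} = L_A` exactly, since a shift-invariant state is one-site tight (`oneSiteTight_of_isShiftInvariant`,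
  `OscillatorChain.measureReal_eq_of_isChainGibbsMeasure_of_tight`) — the superstability clause is not needed;
* events → bounded measurable `f` by the staircase `⌊K f⌋/K` (`BulkWindow.abs_integral_sub_integral_le_of_levelSets`),
  a combination of `2K+1` level-set indicators, applied to the two push-forward laws on `PhaseSpace (m+1)`.

All integrands are bounded and all measures are probability measures (`pinnedChain_isProbabilityMeasure_gibbsMeasure`,
`hG.1`), so no Bochner junk value is hit. No definitions, no named facts.
-/

noncomputable section

open MeasureTheory Set Function Finset Literature.Probability.LatticeModels
open scoped ENNReal

namespace Summit.AtomisticToContinuum.FouriersLaw.Theorems.AbelThermodynamicLimit.SeriesLawAtEveryLaplaceFrequency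

open Literature.MathematicalPhysics.KineticTheory.HeatConduction OscillatorChain

namespace BulkWindow

/-- Enumeration of the lattice interval `{s, …, s+N-1}` by `Fin N`, `k ↦ s + k`. -/
theorem exists_equiv_Icc (s : ℤ) (N : ℕ) :
    ∃ e : Fin N ≃ ↥(Finset.Icc s (s + N - 1)), ∀ k : Fin N, ((e k : ↥(Finset.Icc s (s + N - 1))) : ℤ) = s + k := by
  refine ⟨{ toFun := fun k => ⟨s + k, by simp only [Finset.mem_Icc]; omega⟩,
            invFun := fun x => ⟨(x.1 - s).toNat, by have := Finset.mem_Icc.1 x.2; omega⟩,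
            left_inv := fun k => by ext; simp,
            right_inv := fun x => by
              have := Finset.mem_Icc.1 x.2
              apply Subtype.ext
              simp only
              omega }, fun k => rfl⟩

/-! ### `N`-uniform one-site tails of the free finite-volume Gibbs state -/

section Pinned

variable {ω₂ lam β : ℝ}

/-- **`N`-uniform one-site position tails of the free finite-volume Gibbs state**: there is
`C = C(ω₂, lam, β, T)` with `μ_{N,T}{R < |q_j|} ≤ C/R²` for every `N`, every site `j` and every
`R > 0` (Markov with the `N`-uniform second moments `lightCone_gibbs_position_moments`). -/
theorem pinnedChain_gibbsMeasure_real_position_tail_le (γ : ℝ) (hω : 0 < ω₂) (hl : 0 ≤ lam)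
    (hβ : 0 ≤ β) {T : ℝ} (hT : 0 < T) :
    ∃ C : ℝ, 0 ≤ C ∧ ∀ (N : ℕ) (j : Fin N) (R : ℝ), 0 < R →
      ((pinnedChain ω₂ lam β γ).gibbsMeasure N T).real {z | R < |z.1 j|} ≤ C / R ^ 2 := by
  obtain ⟨C, hC⟩ := Summit.AtomisticToContinuum.FouriersLaw.Theorems.PhononMeanFreePath.lightCone_gibbs_position_moments
    ω₂ lam β γ hω hl hβ T hT 1
  have hC0 : 0 ≤ C := by
    obtain ⟨-, h2⟩ := hC 0 0
    exact le_trans (integral_nonneg fun z => (even_two_mul _).pow_nonneg _) h2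
  refine ⟨C, hC0, fun N j R hR => ?_⟩
  obtain ⟨N', rfl⟩ : ∃ N', N = N' + 1 := ⟨N - 1, by have := j.pos; omega⟩
  obtain ⟨hint, hle⟩ := hC N' j
  set μ := (pinnedChain ω₂ lam β γ).gibbsMeasure (N' + 1) T with hμ
  haveI : IsProbabilityMeasure μ := pinnedChain_isProbabilityMeasure_gibbsMeasure hω hl hβ γ _ hT
  have hsub : {z : PhaseSpace (N' + 1) | R < |z.1 j|} ⊆ {z | R ^ 2 ≤ z.1 j ^ (2 * 1)} := fun z hz => by
    simp only [Set.mem_setOf_eq] at hz ⊢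
    have h1 : R ^ 2 < |z.1 j| ^ 2 := by gcongr
    rw [sq_abs] at h1
    rw [mul_one]
    exact h1.le
  have hmarkov := mul_meas_ge_le_integral_of_nonneg (μ := μ)
    (Filter.Eventually.of_forall fun z => (even_two_mul _).pow_nonneg _) hint (R ^ 2)
  calc μ.real {z | R < |z.1 j|} ≤ μ.real {z | R ^ 2 ≤ z.1 j ^ (2 * 1)} := measureReal_mono hsub
    _ ≤ C / R ^ 2 := by
        rw [le_div_iff₀ (by positivity), mul_comm]
        exact hmarkov.trans hle

end Pinned

/-! ### Uniform approximation by level sets -/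

/-- **Staircase approximation.** For a measurable `f` with `|f| ≤ 1` and `ε > 0` there are `K` and
`δ > 0` such that any two probability laws whose values on the `2K+1` level sets `{⌊K f⌋ = v}`
(`|v| ≤ K`) differ by at most `δ` integrate `f` to within `ε` (`|f - ⌊Kf⌋/K| ≤ 1/K`). -/
theorem abs_integral_sub_integral_le_of_levelSets {X : Type*} [MeasurableSpace X] {f : X → ℝ}
    (hf : Measurable f) (hf1 : ∀ x, |f x| ≤ 1) {ε : ℝ} (hε : 0 < ε) :
    ∃ (K : ℕ) (δ : ℝ), 0 < δ ∧ ∀ (ν₁ ν₂ : Measure X) [IsProbabilityMeasure ν₁] [IsProbabilityMeasure ν₂],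
      (∀ v ∈ Finset.Icc (-(K : ℤ)) K,
        |ν₁.real {x | ⌊(K : ℝ) * f x⌋ = v} - ν₂.real {x | ⌊(K : ℝ) * f x⌋ = v}| ≤ δ) →
      |∫ x, f x ∂ν₁ - ∫ x, f x ∂ν₂| ≤ ε := by
  obtain ⟨K, hK⟩ : ∃ K : ℕ, 4 / ε ≤ K := exists_nat_ge _
  have hKpos : (0 : ℝ) < K := lt_of_lt_of_le (by positivity) hK
  have hK1 : (1 : ℝ) ≤ K := by
    have h0 : K ≠ 0 := by rintro rfl; simp at hKpos
    exact_mod_cast Nat.one_le_iff_ne_zero.2 h0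
  have hK' : 1 / (K : ℝ) ≤ ε / 4 := by
    rw [div_le_iff₀ hKpos]
    rw [div_le_iff₀ hε] at hK
    linarith
  set S : Finset ℤ := Finset.Icc (-(K : ℤ)) K with hS
  have hScard : (0 : ℝ) < S.card := by
    have : (0 : ℤ) ∈ S := by simp [hS]
    exact_mod_cast Finset.card_pos.2 ⟨0, this⟩
  refine ⟨K, ε / (2 * S.card), by positivity, fun ν₁ ν₂ _ _ h => ?_⟩
  -- the staircase `g = ⌊K f⌋ / K`
  set g : X → ℝ := fun x => (⌊(K : ℝ) * f x⌋ : ℝ) / K with hg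
  have hflm : Measurable fun x => ⌊(K : ℝ) * f x⌋ := (hf.const_mul _).floor
  have hgm : Measurable g := ((measurable_of_countable (fun n : ℤ => (n : ℝ))).comp hflm).div_const _
  have hfg : ∀ x, |f x - g x| ≤ 1 / K := fun x => by
    have h1 := Int.floor_le ((K : ℝ) * f x)
    have h2 := Int.lt_floor_add_one ((K : ℝ) * f x)
    have hgle : g x ≤ f x := by
      simp only [hg]; rw [div_le_iff₀ hKpos]; linarith
    have hlt : f x - g x < 1 / K := by
      simp only [hg]
      rw [lt_div_iff₀ hKpos, sub_mul, div_mul_cancel₀ _ hKpos.ne']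
      linarith
    have hK0 : (0 : ℝ) ≤ 1 / K := by positivity
    rw [abs_le]
    exact ⟨by linarith, hlt.le⟩
  -- `g` as a combination of level-set indicators
  have hgsum : ∀ x, g x = ∑ v ∈ S, ((v : ℝ) / K) * ({y | ⌊(K : ℝ) * f y⌋ = v}.indicator 1 x) := by
    intro x
    have hmem : ⌊(K : ℝ) * f x⌋ ∈ S := by
      have hx := abs_le.1 (hf1 x)
      simp only [hS, Finset.mem_Icc]
      constructor
      · rw [Int.le_floor]; push_cast; nlinarith
      · rw [Int.floor_le_iff]; push_cast; nlinarith
    have hterm : ∀ v ∈ S, ((v : ℝ) / K) * ({y | ⌊(K : ℝ) * f y⌋ = v}.indicator 1 x) =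
        if ⌊(K : ℝ) * f x⌋ = v then (v : ℝ) / K else 0 := by
      intro v _
      by_cases hv : ⌊(K : ℝ) * f x⌋ = v
      · rw [if_pos hv, Set.indicator_of_mem (by exact hv), Pi.one_apply, mul_one]
      · rw [if_neg hv, Set.indicator_of_notMem (by exact hv), mul_zero]
    rw [Finset.sum_congr rfl hterm, Finset.sum_ite_eq, if_pos hmem]
  -- integrals of `g`
  have hE : ∀ v, MeasurableSet {y | ⌊(K : ℝ) * f y⌋ = v} := fun v =>
    hflm (measurableSet_singleton v)
  have hgint : ∀ (ν : Measure X) [IsProbabilityMeasure ν],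
      ∫ x, g x ∂ν = ∑ v ∈ S, ((v : ℝ) / K) * ν.real {y | ⌊(K : ℝ) * f y⌋ = v} := by
    intro ν _
    simp_rw [hgsum]
    rw [integral_finsetSum]
    · refine Finset.sum_congr rfl fun v _ => ?_
      rw [integral_const_mul, integral_indicator_one (hE v)]
    · intro v _
      exact ((integrable_const (1 : ℝ)).indicator (hE v)).const_mul _
  -- integrability
  have hfi : ∀ (ν : Measure X) [IsProbabilityMeasure ν], Integrable f ν := fun ν _ =>
    (integrable_const (1 : ℝ)).mono' hf.aestronglyMeasurable
      (Filter.Eventually.of_forall fun x => by rw [Real.norm_eq_abs]; exact hf1 x)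
  have hgi : ∀ (ν : Measure X) [IsProbabilityMeasure ν], Integrable g ν := fun ν _ =>
    (integrable_const (2 : ℝ)).mono' hgm.aestronglyMeasurable
      (Filter.Eventually.of_forall fun x => by
        rw [Real.norm_eq_abs]
        have h1 := hfg x
        have h2 := hf1 x
        have h3 : |g x| ≤ |f x| + |f x - g x| := by
          calc |g x| = |f x - (f x - g x)| := by rw [sub_sub_cancel]
            _ ≤ |f x| + |f x - g x| := abs_sub _ _
        have h4 : 1 / (K : ℝ) ≤ 1 := by rw [div_le_one hKpos]; exact hK1
        linarith)
  have happrox : ∀ (ν : Measure X) [IsProbabilityMeasure ν], |∫ x, f x ∂ν - ∫ x, g x ∂ν| ≤ 1 / K := by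
    intro ν _
    rw [← integral_sub (hfi ν) (hgi ν)]
    have := norm_integral_le_of_norm_le_const (μ := ν) (f := fun x => f x - g x) (C := 1 / K)
      (Filter.Eventually.of_forall fun x => by rw [Real.norm_eq_abs]; exact hfg x)
    rwa [probReal_univ, mul_one, Real.norm_eq_abs] at this
  -- the level-set part
  have hlev : |∫ x, g x ∂ν₁ - ∫ x, g x ∂ν₂| ≤ ε / 2 := by
    rw [hgint ν₁, hgint ν₂, ← Finset.sum_sub_distrib]
    calc |∑ v ∈ S, (((v : ℝ) / K) * ν₁.real {y | ⌊(K : ℝ) * f y⌋ = v} -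
            ((v : ℝ) / K) * ν₂.real {y | ⌊(K : ℝ) * f y⌋ = v})|
        ≤ ∑ v ∈ S, |((v : ℝ) / K) * ν₁.real {y | ⌊(K : ℝ) * f y⌋ = v} -
            ((v : ℝ) / K) * ν₂.real {y | ⌊(K : ℝ) * f y⌋ = v}| := Finset.abs_sum_le_sum_abs _ _
      _ ≤ ∑ v ∈ S, ε / (2 * S.card) := Finset.sum_le_sum fun v hv => by
          rw [← mul_sub, abs_mul]
          have hvK : |(v : ℝ) / K| ≤ 1 := by
            rw [abs_div, abs_of_pos hKpos, div_le_one hKpos]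
            simp only [hS, Finset.mem_Icc] at hv
            rw [← Int.cast_abs]
            exact_mod_cast abs_le.2 ⟨hv.1, hv.2⟩
          calc |(v : ℝ) / K| * |ν₁.real {y | ⌊(K : ℝ) * f y⌋ = v} - ν₂.real {y | ⌊(K : ℝ) * f y⌋ = v}|
              ≤ 1 * (ε / (2 * S.card)) := mul_le_mul hvK (h v hv) (abs_nonneg _) zero_le_one
            _ = _ := one_mul _
      _ = ε / 2 := by
          rw [Finset.sum_const, nsmul_eq_mul]
          field_simp
  -- assemble
  have e₁ := happrox ν₁
  have e₂ := happrox ν₂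
  calc |∫ x, f x ∂ν₁ - ∫ x, f x ∂ν₂|
      = |(∫ x, f x ∂ν₁ - ∫ x, g x ∂ν₁) - (∫ x, f x ∂ν₂ - ∫ x, g x ∂ν₂) +
          (∫ x, g x ∂ν₁ - ∫ x, g x ∂ν₂)| := by ring_nf
    _ ≤ |(∫ x, f x ∂ν₁ - ∫ x, g x ∂ν₁) - (∫ x, f x ∂ν₂ - ∫ x, g x ∂ν₂)| +
          |∫ x, g x ∂ν₁ - ∫ x, g x ∂ν₂| := abs_add_le _ _
    _ ≤ |∫ x, f x ∂ν₁ - ∫ x, g x ∂ν₁| + |∫ x, f x ∂ν₂ - ∫ x, g x ∂ν₂| +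
          |∫ x, g x ∂ν₁ - ∫ x, g x ∂ν₂| := by gcongr; exact abs_sub _ _
    _ ≤ 1 / K + 1 / K + ε / 2 := by gcongr
    _ ≤ ε := by linarith

/-! ### The event version -/

section Pinned

variable {ω₂ lam β : ℝ}

/-- The window read through the embedding of the finite chain with site `i` at the origin is the
window `[i, i+m]` of the finite configuration. -/
theorem boxPhaseAt_embed_Icc {N : ℕ} (i : Fin N) (m : ℕ) (him : i.val + m < N)
    (e : Fin N ≃ ↥(Finset.Icc (-(i.val : ℤ)) (-(i.val : ℤ) + N - 1)))
    (he : ∀ k : Fin N, ((e k : ↥(Finset.Icc (-(i.val : ℤ)) (-(i.val : ℤ) + N - 1))) : ℤ) = -(i.val : ℤ) + k)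
    (η₀ : ChainConfig) (z : PhaseSpace N) :
    boxPhaseAt 0 m (embed (Finset.Icc (-(i.val : ℤ)) (-(i.val : ℤ) + N - 1)) e η₀ z) =
      ((fun j : Fin (m + 1) => z.1 ⟨i.val + j.val, by omega⟩,
        fun j : Fin (m + 1) => z.2 ⟨i.val + j.val, by omega⟩) : PhaseSpace (m + 1)) := by
  have h : ∀ j : Fin (m + 1), embed (Finset.Icc (-(i.val : ℤ)) (-(i.val : ℤ) + N - 1)) e η₀ z
      ((0 : ℤ) + ((j : ℕ) : ℤ)) = (z.1 ⟨i.val + j.val, by omega⟩, z.2 ⟨i.val + j.val, by omega⟩) :=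
    fun j => embed_Icc_apply e he η₀ z _ ⟨i.val + j.val, by omega⟩ (by push_cast; ring)
  refine Prod.ext (funext fun j => ?_) (funext fun j => ?_)
  · rw [boxPhaseAt_fst, h]
  · rw [boxPhaseAt_snd, h]

/-- **Bulk equivalence of ensembles for window EVENTS, anchor-uniform.** For the pinned chain (all
parameters admissible), `T > 0`, a shift-invariant DLR state `μT`, a window length `m+1`, a
measurable `B ⊆ PhaseSpace (m+1)` and `δ > 0` there are `L`, `N₀` with
`|μ_{N,T}{(q,p)|_{[i,i+m]} ∈ B} - μT{boxPhaseAt 0 m ∈ B}| ≤ δ` for all `N ≥ N₀` and all `L`-deep `i`. -/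
theorem pinnedChain_bulkWindow_event (γ : ℝ) (hω : 0 < ω₂) (hl : 0 ≤ lam) (hβ : 0 ≤ β) {T : ℝ}
    (hT : 0 < T) {μT : Measure ChainConfig} (hG : (pinnedChain ω₂ lam β γ).IsChainGibbsMeasure T μT)
    (hS : IsShiftInvariant μT) (m : ℕ) {B : Set (PhaseSpace (m + 1))} (hB : MeasurableSet B)
    {δ : ℝ} (hδ : 0 < δ) :
    ∃ L N₀ : ℕ, ∀ N : ℕ, N₀ ≤ N → ∀ (i : Fin N) (hL : L ≤ i.val) (hi : i.val + m + L < N),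
      |((pinnedChain ω₂ lam β γ).gibbsMeasure N T).real
          {z | ((fun j : Fin (m + 1) => z.1 ⟨i.val + j.val, by omega⟩,
              fun j : Fin (m + 1) => z.2 ⟨i.val + j.val, by omega⟩) : PhaseSpace (m + 1)) ∈ B} -
        μT.real {σ | boxPhaseAt 0 m σ ∈ B}| ≤ δ := by
  haveI : IsProbabilityMeasure μT := hG.1
  have hUc : Continuous (pinnedChain ω₂ lam β γ).U := (pinnedChain_contDiff_U ω₂ lam β γ (n := 0)).continuous
  have hVc : Continuous (pinnedChain ω₂ lam β γ).V := (pinnedChain_contDiff_V ω₂ lam β γ (n := 0)).continuous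
  have hV0 : ∀ r, 0 ≤ (pinnedChain ω₂ lam β γ).V r := fun r => by
    show 0 ≤ r ^ 2 / 2 + β * r ^ 4 / 4; positivity
  have hVe : ∀ r, (pinnedChain ω₂ lam β γ).V (-r) = (pinnedChain ω₂ lam β γ).V r := fun r => by
    show (-r) ^ 2 / 2 + β * (-r) ^ 4 / 4 = r ^ 2 / 2 + β * r ^ 4 / 4; ring
  have hUi : Integrable (fun q : ℝ => Real.exp (-T⁻¹ * (pinnedChain ω₂ lam β γ).U q)) :=
    integrable_exp_neg_pinning hT hω hl β γ
  -- the window event on `ℤ → ℝ × ℝ`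
  set A : Set ChainConfig := boxPhaseAt 0 m ⁻¹' B with hAdef
  have hA : MeasurableSet A := measurable_boxPhaseAt 0 m hB
  have hAd : DependsOn (A.indicator (1 : ChainConfig → ℝ≥0∞)) (↑(Finset.Icc (0 : ℤ) (0 + m)) : Set ℤ) := by
    intro σ σ' h
    have hb : boxPhaseAt 0 m σ = boxPhaseAt 0 m σ' := by
      refine Prod.ext (funext fun j => ?_) (funext fun j => ?_)
      · rw [boxPhaseAt_fst, boxPhaseAt_fst, h _ (by simp only [Finset.coe_Icc, Set.mem_Icc]; omega)]
      · rw [boxPhaseAt_snd, boxPhaseAt_snd, h _ (by simp only [Finset.coe_Icc, Set.mem_Icc]; omega)]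
    have hmem : σ ∈ A ↔ σ' ∈ A := by
      show boxPhaseAt 0 m σ ∈ B ↔ boxPhaseAt 0 m σ' ∈ B
      rw [hb]
    by_cases hσ : σ ∈ A
    · rw [Set.indicator_of_mem hσ, Set.indicator_of_mem (hmem.1 hσ), Pi.one_apply, Pi.one_apply]
    · rw [Set.indicator_of_notMem hσ, Set.indicator_of_notMem fun h' => hσ (hmem.2 h')]
  obtain ⟨LA, hL0, hL1, hlim⟩ :=
    (pinnedChain ω₂ lam β γ).chainSpecification_Icc_tendsto_uniformly hT hUc hVc hV0 hVe hUi 0 m hA hAd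
  have hμT : μT.real {σ | boxPhaseAt 0 m σ ∈ B} = LA :=
    (pinnedChain ω₂ lam β γ).measureReal_eq_of_isChainGibbsMeasure_of_tight hT hUc hVc hV0 hUi hG
      (oneSiteTight_of_isShiftInvariant hS) 0 m hA hL0 hL1 hlim
  -- tails and the choice of `R`, `M`
  obtain ⟨C, hC0, hC⟩ := pinnedChain_gibbsMeasure_real_position_tail_le γ hω hl hβ hT
  set R : ℝ := 4 * C / δ + 1 with hR
  have hRpos : 0 < R := by positivity
  have hR1 : 1 ≤ R := by
    have : 0 ≤ 4 * C / δ := by positivity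
    rw [hR]; linarith
  have hCR : C / R ^ 2 ≤ δ / 4 := by
    have h1 : C / R ^ 2 ≤ C / R :=
      div_le_div_of_nonneg_left hC0 hRpos (by nlinarith)
    have h2 : C / R ≤ δ / 4 := by
      rw [div_le_iff₀ hRpos, hR]
      have : δ / 4 * (4 * C / δ + 1) = C + δ / 4 := by field_simp
      rw [this]; linarith
    exact h1.trans h2
  obtain ⟨M, hM⟩ := hlim R (δ / 2) (by positivity)
  refine ⟨M + 1, 0, fun N _ i hL hi => ?_⟩
  obtain ⟨e, he⟩ := exists_equiv_Icc (-(i.val : ℤ)) N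
  set η₀ : ChainConfig := fun _ => (0, 0) with hη₀
  have hwin : {z : PhaseSpace N | ((fun j : Fin (m + 1) => z.1 ⟨i.val + j.val, by omega⟩,
      fun j : Fin (m + 1) => z.2 ⟨i.val + j.val, by omega⟩) : PhaseSpace (m + 1)) ∈ B} =
      (embed (Finset.Icc (-(i.val : ℤ)) (-(i.val : ℤ) + N - 1)) e η₀) ⁻¹' A := by
    ext z
    simp only [Set.mem_setOf_eq, Set.mem_preimage, hAdef]
    rw [boxPhaseAt_embed_Icc i m (by omega) e he η₀ z]
  have hmain := pinnedChain_windowEventDLREstimate ω₂ lam β γ hω hl hβ T hT m _ hA LA R (δ / 2) hL0 hL1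
    (by positivity) M (hM M le_rfl) N i hL (by omega) e he η₀
  have ht₁ := hC N ⟨i.val - M - 1, by omega⟩ R hRpos
  have ht₂ := hC N ⟨i.val + m + M + 1, by omega⟩ R hRpos
  rw [hwin, hμT, measureReal_def]
  linarith

end Pinned

end BulkWindow

/-- **Registered stub (E1) `stub_bulkWindowEquivalence` — BULK EQUIVALENCE OF ENSEMBLES, anchor-uniform.**
For the pinned anharmonic chain (all parameters `> 0`), `T > 0` and a regular DLR state `μT`
(DLR + shift-invariant + BM-superstable): expectations of a bounded measurable window observable
under the free finite-volume Gibbs state `gibbsMeasure N T`, read on an `L`-deep window `[i, i+m]`,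
agree within `ε` with its `μT`-expectation on `[0, m]`, uniformly over deep anchors. Proof: the
free finite chain is DLR in the bulk for the infinite-chain specification; window probabilities of
the specification forget far boundary conditions uniformly on bounded boundary positions
(transfer operator); `N`-uniform one-site tails of `gibbsMeasure N T`; tightness of the
shift-invariant `μT`; staircase approximation of `f`. -/
theorem stub_bulkWindowEquivalence :
    ∀ ω₂ lam β γ : ℝ, 0 < ω₂ → 0 < lam → 0 < β → 0 < γ → ∀ T : ℝ, 0 < T →
      ∀ μT : MeasureTheory.Measure Literature.MathematicalPhysics.KineticTheory.HeatConduction.ChainConfig,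
        (Literature.MathematicalPhysics.KineticTheory.HeatConduction.pinnedChain ω₂ lam β γ).IsChainGibbsMeasure T μT →
        Literature.MathematicalPhysics.KineticTheory.HeatConduction.IsShiftInvariant μT →
        (Literature.MathematicalPhysics.KineticTheory.HeatConduction.pinnedChain ω₂ lam β γ).HasSuperstabilityEstimate μT →
        ∀ (m : ℕ) (f : Literature.MathematicalPhysics.KineticTheory.HeatConduction.PhaseSpace (m + 1) → ℝ),
          Measurable f → (∀ w, |f w| ≤ 1) →
          ∀ ε : ℝ, 0 < ε → ∃ L N₀ : ℕ, ∀ N : ℕ, N₀ ≤ N → ∀ (i : Fin N) (hL : L ≤ i.val) (hi : i.val + m + L < N),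
            |(∫ z, f (fun j : Fin (m + 1) => z.1 ⟨i.val + j.val, by omega⟩,
                      fun j : Fin (m + 1) => z.2 ⟨i.val + j.val, by omega⟩)
                ∂((Literature.MathematicalPhysics.KineticTheory.HeatConduction.pinnedChain ω₂ lam β γ).gibbsMeasure N T)) -
              ∫ σ, f (Literature.MathematicalPhysics.KineticTheory.HeatConduction.boxPhaseAt 0 m σ) ∂μT| ≤ ε := by
  intro ω₂ lam β γ hω hl hβ _hγ T hT μT hG hS _hSS m f hf hf1 ε hε
  obtain ⟨K, δ, hδ, hK⟩ := BulkWindow.abs_integral_sub_integral_le_of_levelSets hf hf1 hε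
  have hE : ∀ v : ℤ, MeasurableSet {w : PhaseSpace (m + 1) | ⌊(K : ℝ) * f w⌋ = v} := fun v =>
    (hf.const_mul _).floor (measurableSet_singleton v)
  choose Lf Nf hLN using fun v : ℤ =>
    BulkWindow.pinnedChain_bulkWindow_event γ hω hl.le hβ.le hT hG hS m (hE v) hδ
  refine ⟨(Finset.Icc (-(K : ℤ)) K).sup Lf, (Finset.Icc (-(K : ℤ)) K).sup Nf, fun N hN i hL hi => ?_⟩
  haveI := pinnedChain_isProbabilityMeasure_gibbsMeasure hω hl.le hβ.le γ N hT
  haveI : IsProbabilityMeasure μT := hG.1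
  set win : PhaseSpace N → PhaseSpace (m + 1) := fun z =>
    (fun j : Fin (m + 1) => z.1 ⟨i.val + j.val, by omega⟩,
      fun j : Fin (m + 1) => z.2 ⟨i.val + j.val, by omega⟩) with hwin
  have hwm : Measurable win :=
    (measurable_pi_lambda _ fun j => (measurable_pi_apply _).comp measurable_fst).prodMk
      (measurable_pi_lambda _ fun j => (measurable_pi_apply _).comp measurable_snd)
  haveI : IsProbabilityMeasure (((pinnedChain ω₂ lam β γ).gibbsMeasure N T).map win) :=
    Measure.isProbabilityMeasure_map hwm.aemeasurable
  haveI : IsProbabilityMeasure (μT.map (boxPhaseAt 0 m)) :=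
    Measure.isProbabilityMeasure_map (measurable_boxPhaseAt 0 m).aemeasurable
  have h := hK (((pinnedChain ω₂ lam β γ).gibbsMeasure N T).map win) (μT.map (boxPhaseAt 0 m))
    (fun v hv => by
      rw [map_measureReal_apply hwm (hE v), map_measureReal_apply (measurable_boxPhaseAt 0 m) (hE v)]
      have h1 : Lf v ≤ (Finset.Icc (-(K : ℤ)) K).sup Lf := Finset.le_sup hv
      have h2 : Nf v ≤ (Finset.Icc (-(K : ℤ)) K).sup Nf := Finset.le_sup hv
      exact hLN v N (h2.trans hN) i (h1.trans hL) (by omega))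
  rw [integral_map hwm.aemeasurable hf.aestronglyMeasurable,
    integral_map (measurable_boxPhaseAt 0 m).aemeasurable hf.aestronglyMeasurable] at h
  exact h

end Summit.AtomisticToContinuum.FouriersLaw.Theorems.AbelThermodynamicLimit.SeriesLawAtEveryLaplaceFrequency

end
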